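import Summits.BirchSwinnertonDyer.BirchSwinnertonDyer.Theorems.KatoDescentPotSupersingularUnitIndexMuDoors
import HarnessLib

/-!
# K9 `WildCoatesSujathaResidue` (19942) / node 19189 / item 19197 — FUKUDA at ANY pair of consecutive layers `(n, n+1)`, class-number form
# (Thm. 1 (1)) and `p`-RANK form (Thm. 1 (2)), on `K⁺ = ℚ(W[3])^c` (Cartan rows) and on `L_P = ℚ(W[3])^{U_P}`: (A) at `(W,3)` / U₀ doors
# (cell `bsd-potss`, seat `bsd-potss-k9-c4` g19; route-free; `--supports` 19197 / 19942; closes nothing; sequel of `…UnitIndexMuDoors`)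

HONEST FRAMING. THEOREMS ONLY (no definition, no named fact, no `sorry`), one-step compositions of LANDED theorems (this seat's g18
`CartanMuRoadRealDoors`, conjA-anchor g9's `Lim2017.fineSelmerDual_moduleFinite_of_{classNumberPExp,classGroupPRank}_succ_eq_unipotentStabilizerField`,
k9-c4 g5's `missingUpperBoundAt_wild_of_conjA`, and the tree corollaries `classicalMuVanishes_of_classNumberPExp_succ_eq` /
`classicalMuVanishes_of_classGroupPRank_succ_eq` of the NAMED FACTS Fukuda 1994 Thm. 1 (1) / (2)); per-row DOORS whose numeric hypotheses
(`hram`: Fukuda index `0`; `hord`: `e_{n+1} = e_n`; `hrk`: `rank_{n+1} = rank_n`) are displayed and certified per row by PARI/GP; CONDITIONAL on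
the named facts; (A), Conjecture A and BSD proved for NO curve; items stay OPEN class-wide (open input: zeta crux 24327).
WHY (kit j308602, `--workitem 19197`): the `3Ns` maximal real subfields `K⁺` that GROW at layers `(0,1)` settle at `(1,2)` — `e = 0, 1, 1` for
`ℚ[x]/(x⁴−x³−14x²+33x−15)` (rows 28566bk1, 371358bt1) and `ℚ[x]/(x⁴−39x²−130x−156)` (228150bi1/bv1); `e = 0, 1, 2` but `rank₃ = 0, 1, 1` for
`ℚ[x]/(x⁴+22x²−11)` (261360he1/iv1) — layer `1` (degree 12) certified by `bnfcertify`, layer `2` (degree 36) under GRH.  The `n = 0` doors of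
`…UnitIndexMuDoors` §2 are the special case; these take `n` as a parameter.

References: [Fukuda1994] Thm. 1 (1), (2), p. 264; [Lim2017FineSelmer] §3 Thm. 3.5; [CoatesSujatha2005] Thm. 3.4; [Kato2004Asterisque] Thm. 14.5 (3);
[Serre1972] §2.2, §5.2; [Washington1997] §13.1.
-/

set_option linter.dupNamespace false
set_option autoImplicit false

noncomputable section

open scoped NumberField
open Field IntermediateField WeierstrassCurve IsDedekindDomain Literature.NumberTheory.EllipticCurves
  Literature.NumberTheory.GaloisRepresentations Literature.NumberTheory.SerreUniformity
  Literature.NumberTheory.IwasawaTheory Literature.NumberTheory.EllipticCurves.Rank1Residual.Typed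
  Summit.BirchSwinnertonDyer.Rank1Residual.Additive

namespace Summit.BirchSwinnertonDyer.BirchSwinnertonDyer.Theorems.UnitIndexMuDoors

/-! ## §4 Fukuda at ANY pair of consecutive layers `(n, n+1)`, in class-number form (Thm. 1 (1))
and in `p`-RANK form (Thm. 1 (2)), on `K⁺` (Cartan rows) and on `L_P` — the `3Ns` maximal real subfields that GROW at `(0,1)` settle at
`(1,2)`: `e = 0,1,1` (28566bk1/371358bt1, 228150bi1/bv1) or `rank = 0,1,1` with `e = 0,1,2` (261360he1/iv1); degree-`36` layers under GRH. -/

section FukudaAt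

variable (W : WeierstrassCurve ℚ) [W.IsElliptic]

set_option synthInstance.maxHeartbeats 400000 in
set_option maxHeartbeats 4000000 in
/-- **(A) at `(W,3)` on a `3Ns` row from FUKUDA Thm. 1 (1) at layers `(n, n+1)` on `K⁺ = ℚ(W[3])^c`** (modulo `hCS`, `hFW`, `hF1`): Fukuda
index `0` (`hram`) and `ord₃ h(Kp_{n+1}) = ord₃ h(Kp_n)` (`hord`) for every cyclotomic `ℤ_3`-extension of `Kp`. [cite: Fukuda1994, Thm. 1 (1), p. 264]
[cite: CoatesSujatha2005, Thm. 3.4 (§3)] [cite: Serre1972, §5.2 (iv)] -/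
theorem conjA_three_of_hasSplitCartanNormalizerModPImage_of_realSuccEqAt
    (hCS : CoatesSujatha2005.thm34_fineSelmerDual_moduleFinite_of_classicalMuVanishes_divisionField)
    (hFW : ferreroWashington1979_classicalMuVanishes) (hF1 : fukuda1994_thm1_classNumberPExp_const_of_succ_eq)
    (himg : HasSplitCartanNormalizerModPImage W 3)
    {c : absoluteGaloisGroup ℚ} (hc : IsComplexConjugation (Rat.castHom ℝ) c)
    (Kp : IntermediateField ℚ ↥(W.divisionField 3)) (hKp : Kp = fixedField (Subgroup.zpowers (absRestrictNormalHom (W.divisionField 3) c)))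
    (n : ℕ) (hram : ∀ κE : ZpExtension ↥Kp 3, κE.IsCyclotomic → TotallyRamifiedFrom κE 0)
    (hord : ∀ κE : ZpExtension ↥Kp 3, κE.IsCyclotomic → classNumberPExp κE (n + 1) = classNumberPExp κE n)
    (κ : ZpExtension ℚ 3) (hκ : κ.IsCyclotomic) :
    ∃ (γ : absoluteGaloisGroup ℚ) (D : W.FineSelmerDualData κ γ),
      Module.Finite ℤ_[3] (RestrictScalars ℤ_[3] (IwasawaAlgebra 3) D.X) := by
  haveI : NumberField ↥(W.divisionField 3) := NumberField.mk
  subst hKp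
  exact CartanMuRoadRealDoors.conjA_three_of_hasSplitCartanNormalizerModPImage_of_realMu W hCS hFW himg hc
    (fun κE hκE => classicalMuVanishes_of_classNumberPExp_succ_eq hF1 κE (hram κE hκE) (Nat.zero_le n) (hord κE hκE)) κ hκ

set_option synthInstance.maxHeartbeats 400000 in
set_option maxHeartbeats 4000000 in
/-- **(A) at `(W,3)` on a `3Ns` row from FUKUDA Thm. 1 (2) (`p`-RANKS) at layers `(n, n+1)` on `K⁺ = ℚ(W[3])^c`** (modulo `hCS`, `hFW` and the
named fact `fukuda1994_thm1_classGroupPRank_const_of_succ_eq` `hF2`): Fukuda index `0` (`hram`) and `rank₃ Cl(Kp_{n+1}) = rank₃ Cl(Kp_n)` (`hrk`).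
[cite: Fukuda1994, Thm. 1 (2), p. 264] [cite: CoatesSujatha2005, Thm. 3.4 (§3)] [cite: Serre1972, §5.2 (iv)] -/
theorem conjA_three_of_hasSplitCartanNormalizerModPImage_of_realRankSuccEqAt
    (hCS : CoatesSujatha2005.thm34_fineSelmerDual_moduleFinite_of_classicalMuVanishes_divisionField)
    (hFW : ferreroWashington1979_classicalMuVanishes) (hF2 : fukuda1994_thm1_classGroupPRank_const_of_succ_eq)
    (himg : HasSplitCartanNormalizerModPImage W 3)
    {c : absoluteGaloisGroup ℚ} (hc : IsComplexConjugation (Rat.castHom ℝ) c)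
    (Kp : IntermediateField ℚ ↥(W.divisionField 3)) (hKp : Kp = fixedField (Subgroup.zpowers (absRestrictNormalHom (W.divisionField 3) c)))
    (n : ℕ) (hram : ∀ κE : ZpExtension ↥Kp 3, κE.IsCyclotomic → TotallyRamifiedFrom κE 0)
    (hrk : ∀ κE : ZpExtension ↥Kp 3, κE.IsCyclotomic → classGroupPRank κE (n + 1) = classGroupPRank κE n)
    (κ : ZpExtension ℚ 3) (hκ : κ.IsCyclotomic) :
    ∃ (γ : absoluteGaloisGroup ℚ) (D : W.FineSelmerDualData κ γ),
      Module.Finite ℤ_[3] (RestrictScalars ℤ_[3] (IwasawaAlgebra 3) D.X) := by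
  haveI : NumberField ↥(W.divisionField 3) := NumberField.mk
  subst hKp
  exact CartanMuRoadRealDoors.conjA_three_of_hasSplitCartanNormalizerModPImage_of_realMu W hCS hFW himg hc
    (fun κE hκE => classicalMuVanishes_of_classGroupPRank_succ_eq hF2 κE (hram κE hκE) (Nat.zero_le n) (hrk κE hκE)) κ hκ

variable [W.IsGloballyMinimal]

set_option synthInstance.maxHeartbeats 400000 in
set_option maxHeartbeats 4000000 in
/-- **U₀ at a `3Ns` residue row from FUKUDA Thm. 1 (1) at layers `(n, n+1)` on `K⁺`** (named facts {A161-fine, GZK, modularity, `hCS`, `hFW`,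
`hF1`} + displayed `hram`, `hord` about `Kp = ℚ(W[3])^c`). CONDITIONAL; nothing booked; BSD for no curve.
[cite: Kato2004Asterisque, Thm. 14.5 (3) (p. 236)] [cite: Fukuda1994, Thm. 1 (1), p. 264] [cite: CoatesSujatha2005, Thm. 3.4 (§3)] -/
theorem missingUpperBoundAt_three_of_hasSplitCartanNormalizerModPImage_of_realSuccEqAt
    (hKatoA : Kato2004.rankZero_padicValNat_sha_add_padicValNat_tamagawa_le_of_additive_potGood_of_irreducible_of_fineSelmerDual_fg)
    (hGZK : rank_eq_analyticRank_of_analyticRank_le_one) (hmod : hasEntireLFunction_rat)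
    (hCS : CoatesSujatha2005.thm34_fineSelmerDual_moduleFinite_of_classicalMuVanishes_divisionField)
    (hFW : ferreroWashington1979_classicalMuVanishes) (hF1 : fukuda1994_thm1_classNumberPExp_const_of_succ_eq) [Fact (3 : ℕ).Prime]
    (hr : W.analyticRank = 0) (hO : ClassO6 W 3) (hirr : W.HasIrreducibleModPGaloisRep 3)
    (himg : HasSplitCartanNormalizerModPImage W 3)
    {c : absoluteGaloisGroup ℚ} (hc : IsComplexConjugation (Rat.castHom ℝ) c)
    (Kp : IntermediateField ℚ ↥(W.divisionField 3)) (hKp : Kp = fixedField (Subgroup.zpowers (absRestrictNormalHom (W.divisionField 3) c)))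
    (n : ℕ) (hram : ∀ κE : ZpExtension ↥Kp 3, κE.IsCyclotomic → TotallyRamifiedFrom κE 0)
    (hord : ∀ κE : ZpExtension ↥Kp 3, κE.IsCyclotomic → classNumberPExp κE (n + 1) = classNumberPExp κE n) :
    MissingUpperBoundAt W 3 :=
  WildFineSelmerSupersingularCMAnchor.missingUpperBoundAt_wild_of_conjA hKatoA hGZK hmod W hr hO hirr
    (conjA_three_of_hasSplitCartanNormalizerModPImage_of_realSuccEqAt W hCS hFW hF1 himg hc Kp hKp n hram hord)

set_option synthInstance.maxHeartbeats 400000 in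
set_option maxHeartbeats 4000000 in
/-- **U₀ at a `3Ns` residue row from FUKUDA Thm. 1 (2) (`p`-RANKS) at layers `(n, n+1)` on `K⁺`** (named facts {A161-fine, GZK, modularity,
`hCS`, `hFW`, `hF2`} + displayed `hram`, `hrk` about `Kp = ℚ(W[3])^c`). CONDITIONAL; nothing booked; BSD for no curve.
[cite: Kato2004Asterisque, Thm. 14.5 (3) (p. 236)] [cite: Fukuda1994, Thm. 1 (2), p. 264] [cite: CoatesSujatha2005, Thm. 3.4 (§3)] -/
theorem missingUpperBoundAt_three_of_hasSplitCartanNormalizerModPImage_of_realRankSuccEqAt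
    (hKatoA : Kato2004.rankZero_padicValNat_sha_add_padicValNat_tamagawa_le_of_additive_potGood_of_irreducible_of_fineSelmerDual_fg)
    (hGZK : rank_eq_analyticRank_of_analyticRank_le_one) (hmod : hasEntireLFunction_rat)
    (hCS : CoatesSujatha2005.thm34_fineSelmerDual_moduleFinite_of_classicalMuVanishes_divisionField)
    (hFW : ferreroWashington1979_classicalMuVanishes) (hF2 : fukuda1994_thm1_classGroupPRank_const_of_succ_eq) [Fact (3 : ℕ).Prime]
    (hr : W.analyticRank = 0) (hO : ClassO6 W 3) (hirr : W.HasIrreducibleModPGaloisRep 3)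
    (himg : HasSplitCartanNormalizerModPImage W 3)
    {c : absoluteGaloisGroup ℚ} (hc : IsComplexConjugation (Rat.castHom ℝ) c)
    (Kp : IntermediateField ℚ ↥(W.divisionField 3)) (hKp : Kp = fixedField (Subgroup.zpowers (absRestrictNormalHom (W.divisionField 3) c)))
    (n : ℕ) (hram : ∀ κE : ZpExtension ↥Kp 3, κE.IsCyclotomic → TotallyRamifiedFrom κE 0)
    (hrk : ∀ κE : ZpExtension ↥Kp 3, κE.IsCyclotomic → classGroupPRank κE (n + 1) = classGroupPRank κE n) :
    MissingUpperBoundAt W 3 :=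
  WildFineSelmerSupersingularCMAnchor.missingUpperBoundAt_wild_of_conjA hKatoA hGZK hmod W hr hO hirr
    (conjA_three_of_hasSplitCartanNormalizerModPImage_of_realRankSuccEqAt W hCS hFW hF2 himg hc Kp hKp n hram hrk)

/-- **U₀ at a residue row from FUKUDA Thm. 1 (1) at layers `(n, n+1)` on `L_P = ℚ(W[3])^{U_P}`** (conjA-anchor g9's door at any `n`, then
k9-c4 g5's `missingUpperBoundAt_wild_of_conjA`): named facts {A161-fine, GZK, modularity, `hLim`, `hF1`} + displayed `hram` / `hord` on `L_P`.
(388800ho1: `e(L_P) = 0, 1, ?` — the layer-`2` class number of the octic `ℚ(P)`, degree `72`, decides it by Kuroda.) CONDITIONAL; nothing booked.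
[cite: Kato2004Asterisque, Thm. 14.5 (3) (p. 236)] [cite: Lim2017FineSelmer, §3 Thm. 3.5 and Lemma 3.2 (arXiv:1306.2047 pp. 6–7)]
[cite: Fukuda1994, Thm. 1 (1), p. 264] -/
theorem missingUpperBoundAt_three_of_classNumberPExp_succ_eqAt_unipotentStabilizerField
    (hKatoA : Kato2004.rankZero_padicValNat_sha_add_padicValNat_tamagawa_le_of_additive_potGood_of_irreducible_of_fineSelmerDual_fg)
    (hGZK : rank_eq_analyticRank_of_analyticRank_le_one) (hmod : hasEntireLFunction_rat)
    (hLim : Lim2017.thm35_fineSelmerDual_moduleFinite_of_classicalMuVanishes_of_le_divisionField)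
    (hF1 : fukuda1994_thm1_classNumberPExp_const_of_succ_eq) [Fact (3 : ℕ).Prime]
    (hr : W.analyticRank = 0) (hO : ClassO6 W 3) (hirr : W.HasIrreducibleModPGaloisRep 3) (P : W.geomTorsion (3 : ℕ)) (n : ℕ)
    (hram : ∀ κ : ZpExtension ↥(W.unipotentStabilizerField 3 P) 3, κ.IsCyclotomic → TotallyRamifiedFrom κ 0)
    (hord : ∀ κ : ZpExtension ↥(W.unipotentStabilizerField 3 P) 3, κ.IsCyclotomic →
      classNumberPExp κ (n + 1) = classNumberPExp κ n) :
    MissingUpperBoundAt W 3 :=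
  WildFineSelmerSupersingularCMAnchor.missingUpperBoundAt_wild_of_conjA hKatoA hGZK hmod W hr hO hirr
    (Lim2017.fineSelmerDual_moduleFinite_of_classNumberPExp_succ_eq_unipotentStabilizerField hF1 hLim W 3 (by decide) n P hram hord)

/-- **U₀ at a residue row from FUKUDA Thm. 1 (2) (`p`-RANKS) at layers `(n, n+1)` on `L_P`** (conjA-anchor g9's rank door, then
`missingUpperBoundAt_wild_of_conjA`): named facts {A161-fine, GZK, modularity, `hLim`, `hF2`} + displayed `hram` / `hrk` on `L_P`. CONDITIONAL;
nothing booked; BSD for no curve. [cite: Kato2004Asterisque, Thm. 14.5 (3) (p. 236)]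
[cite: Lim2017FineSelmer, §3 Thm. 3.5 and Lemma 3.2 (arXiv:1306.2047 pp. 6–7)] [cite: Fukuda1994, Thm. 1 (2), p. 264] -/
theorem missingUpperBoundAt_three_of_classGroupPRank_succ_eqAt_unipotentStabilizerField
    (hKatoA : Kato2004.rankZero_padicValNat_sha_add_padicValNat_tamagawa_le_of_additive_potGood_of_irreducible_of_fineSelmerDual_fg)
    (hGZK : rank_eq_analyticRank_of_analyticRank_le_one) (hmod : hasEntireLFunction_rat)
    (hLim : Lim2017.thm35_fineSelmerDual_moduleFinite_of_classicalMuVanishes_of_le_divisionField)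
    (hF2 : fukuda1994_thm1_classGroupPRank_const_of_succ_eq) [Fact (3 : ℕ).Prime]
    (hr : W.analyticRank = 0) (hO : ClassO6 W 3) (hirr : W.HasIrreducibleModPGaloisRep 3) (P : W.geomTorsion (3 : ℕ)) (n : ℕ)
    (hram : ∀ κ : ZpExtension ↥(W.unipotentStabilizerField 3 P) 3, κ.IsCyclotomic → TotallyRamifiedFrom κ 0)
    (hrk : ∀ κ : ZpExtension ↥(W.unipotentStabilizerField 3 P) 3, κ.IsCyclotomic →
      classGroupPRank κ (n + 1) = classGroupPRank κ n) :
    MissingUpperBoundAt W 3 :=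
  WildFineSelmerSupersingularCMAnchor.missingUpperBoundAt_wild_of_conjA hKatoA hGZK hmod W hr hO hirr
    (Lim2017.fineSelmerDual_moduleFinite_of_classGroupPRank_succ_eq_unipotentStabilizerField hF2 hLim W 3 (by decide) n P hram hrk)

end FukudaAt

end Summit.BirchSwinnertonDyer.BirchSwinnertonDyer.Theorems.UnitIndexMuDoors

end
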